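import Summits.CriticalPhenomena.PercolationContinuityZ3.Theorems.PercTiltedBlockersCubeBlockingSeedSecondEntrance
import Summits.CriticalPhenomena.PercolationContinuityZ3.Theorems.PercNonProliferationSubpolynomialBlockingUniquenessCrossRoute
import HarnessLib

/-!
# Crux `CubeBlockingSeed` (stmt-CriticalPhenomena-1141), line `registered` — the crux from `FlatAnnulusCrossing` and the
# tall halving rung alone, and the rung's consistency with `X_B`, importable

Helper file of the line lead c1 (`--supports stmt-CriticalPhenomena-1141`, registered sub-goal
`stub_cruxOfFlatAnnulusCrossingOfHalvingRung`). The planner menu for the comparison input of this crux, certified: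

* Option A (two bounded-shape items, each certified CONSISTENT with `X_B = CritAnnulusNonCrossing` (stmt-0846), which both routes bet on):
  the TALL halving rung `HalvingRung :≡ ∀ k ≥ 1, SeedAt (2k) → SeedAt k` (inf-form; `SeedAt k :≡ ∃ c > 0, ∀ n ≥ 1,
  β_{p_c}(kn; n, n) ≥ c`) for this crux, and the flat height halving `HH_flat` of the 6393 lead for `TiltComparison`.
  This file: `stub_cruxOfFlatAnnulusCrossingOfHalvingRung` / `cubeBlockingSeed_of_flatAnnulusCrossing_of_halvingRung` —
  **`FlatAnnulusCrossing (6699) ∧ HalvingRung ⟹ CubeBlockingSeed`** (ladder p149603 + tube seed from 6699 p149647);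
  `halvingRung_of_critAnnulusNonCrossing` — **`X_B (0846) ⟹ HalvingRung`** (0846 ⟹ 1141, `UniquenessCrossRoute`, then
  `halvingRung_of_cubeBlockingSeed`); `cubeBlockingSeed_iff_halvingRung_of_flatAnnulusCrossing` — **given 6699, the crux is
  EQUIVALENT to the tall halving rung**.
* Option B (one item): the bounded-aspect height halving `HeightHalving12` of `…CubeBlockingSeedOfHeightHalving12.lean` (p154610),
  which implies both Option-A statements (`halvingRung_of_heightHalving12`, `heightHalvingFlat_of_heightHalving12`).

No definitions; no unproved facts (open statements enter as hypotheses, written out in tree vocabulary).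
-/

noncomputable section

namespace Summit.CriticalPhenomena.PercolationContinuityZ3.Theorems.CubeBlockingSeed

open MeasureTheory Literature.Probability.Percolation Literature.Probability.LatticeModels
open Summit.CriticalPhenomena.PercolationContinuityZ3.Theses

/-- **`stub_cruxOfFlatAnnulusCrossingOfHalvingRung`** (registered sub-goal of crux stmt-CriticalPhenomena-1141):
`FlatAnnulusCrossing` (stmt-6699) and the tall halving rung `∀ k ≥ 1, SeedAt (2k) → SeedAt k` (registered text of the line's
original `stub_halvingRung`) imply the crux's body: tube seed from 6699 (`stub_tallSeedOfFlatAnnulusCrossing`) and the ladder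
(`stub_ladder`). [folklore] -/
theorem stub_cruxOfFlatAnnulusCrossingOfHalvingRung :
    PercDivergentSlabLadder.FlatAnnulusCrossing →
      (∀ k : ℕ, 1 ≤ k →
        (∃ c : ℝ, 0 < c ∧ ∀ n : ℕ, 1 ≤ n →
          c ≤ (bondPercolation (zdGraph 3) (criticalProbI 3)).real
            {ω | ¬ ∃ x ∈ Finset.Icc (0 : Site 3) ![((2 * k * n : ℕ) : ℤ), n, n],
              ∃ y ∈ Finset.Icc (0 : Site 3) ![((2 * k * n : ℕ) : ℤ), n, n],
                x 0 = 0 ∧ y 0 = ((2 * k * n : ℕ) : ℤ) ∧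
                  ω ∈ openConnIn ↑(Finset.Icc (0 : Site 3) ![((2 * k * n : ℕ) : ℤ), n, n]) x y}) →
        ∃ c : ℝ, 0 < c ∧ ∀ n : ℕ, 1 ≤ n →
          c ≤ (bondPercolation (zdGraph 3) (criticalProbI 3)).real
            {ω | ¬ ∃ x ∈ Finset.Icc (0 : Site 3) ![((k * n : ℕ) : ℤ), n, n],
              ∃ y ∈ Finset.Icc (0 : Site 3) ![((k * n : ℕ) : ℤ), n, n],
                x 0 = 0 ∧ y 0 = ((k * n : ℕ) : ℤ) ∧
                  ω ∈ openConnIn ↑(Finset.Icc (0 : Site 3) ![((k * n : ℕ) : ℤ), n, n]) x y}) →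
      ∃ c : ℝ, 0 < c ∧ ∀ n : ℕ, 1 ≤ n → c ≤ (bondPercolation (zdGraph 3) (criticalProbI 3)).real
        {ω | ¬ ∃ x ∈ Finset.Icc (0 : Site 3) ![(n : ℤ), n, n], ∃ y ∈ Finset.Icc (0 : Site 3) ![(n : ℤ), n, n],
          x 0 = 0 ∧ y 0 = n ∧ ω ∈ openConnIn ↑(Finset.Icc (0 : Site 3) ![(n : ℤ), n, n]) x y} :=
  fun h6699 hR => stub_ladder (stub_tallSeedOfFlatAnnulusCrossing h6699) hR

/-- `FlatAnnulusCrossing (6699) ∧ HalvingRung ⟹ CubeBlockingSeed`, concluding the item's primary decl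
`Theses.PercAnnulusCrossing.CubeBlockingSeed` by name. [folklore] -/
theorem cubeBlockingSeed_of_flatAnnulusCrossing_of_halvingRung
    (h6699 : PercDivergentSlabLadder.FlatAnnulusCrossing)
    (hR : ∀ k : ℕ, 1 ≤ k →
        (∃ c : ℝ, 0 < c ∧ ∀ n : ℕ, 1 ≤ n →
          c ≤ (bondPercolation (zdGraph 3) (criticalProbI 3)).real
            {ω | ¬ ∃ x ∈ Finset.Icc (0 : Site 3) ![((2 * k * n : ℕ) : ℤ), n, n],
              ∃ y ∈ Finset.Icc (0 : Site 3) ![((2 * k * n : ℕ) : ℤ), n, n],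
                x 0 = 0 ∧ y 0 = ((2 * k * n : ℕ) : ℤ) ∧
                  ω ∈ openConnIn ↑(Finset.Icc (0 : Site 3) ![((2 * k * n : ℕ) : ℤ), n, n]) x y}) →
        ∃ c : ℝ, 0 < c ∧ ∀ n : ℕ, 1 ≤ n →
          c ≤ (bondPercolation (zdGraph 3) (criticalProbI 3)).real
            {ω | ¬ ∃ x ∈ Finset.Icc (0 : Site 3) ![((k * n : ℕ) : ℤ), n, n],
              ∃ y ∈ Finset.Icc (0 : Site 3) ![((k * n : ℕ) : ℤ), n, n],
                x 0 = 0 ∧ y 0 = ((k * n : ℕ) : ℤ) ∧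
                  ω ∈ openConnIn ↑(Finset.Icc (0 : Site 3) ![((k * n : ℕ) : ℤ), n, n]) x y}) :
    PercAnnulusCrossing.CubeBlockingSeed :=
  stub_cruxOfFlatAnnulusCrossingOfHalvingRung h6699 hR

/-- The same for the verbatim twin `Theses.PercTiltedBlockers.CubeBlockingSeed`. [folklore] -/
theorem cubeBlockingSeed'_of_flatAnnulusCrossing_of_halvingRung
    (h6699 : PercDivergentSlabLadder.FlatAnnulusCrossing)
    (hR : ∀ k : ℕ, 1 ≤ k →
        (∃ c : ℝ, 0 < c ∧ ∀ n : ℕ, 1 ≤ n →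
          c ≤ (bondPercolation (zdGraph 3) (criticalProbI 3)).real
            {ω | ¬ ∃ x ∈ Finset.Icc (0 : Site 3) ![((2 * k * n : ℕ) : ℤ), n, n],
              ∃ y ∈ Finset.Icc (0 : Site 3) ![((2 * k * n : ℕ) : ℤ), n, n],
                x 0 = 0 ∧ y 0 = ((2 * k * n : ℕ) : ℤ) ∧
                  ω ∈ openConnIn ↑(Finset.Icc (0 : Site 3) ![((2 * k * n : ℕ) : ℤ), n, n]) x y}) →
        ∃ c : ℝ, 0 < c ∧ ∀ n : ℕ, 1 ≤ n →
          c ≤ (bondPercolation (zdGraph 3) (criticalProbI 3)).real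
            {ω | ¬ ∃ x ∈ Finset.Icc (0 : Site 3) ![((k * n : ℕ) : ℤ), n, n],
              ∃ y ∈ Finset.Icc (0 : Site 3) ![((k * n : ℕ) : ℤ), n, n],
                x 0 = 0 ∧ y 0 = ((k * n : ℕ) : ℤ) ∧
                  ω ∈ openConnIn ↑(Finset.Icc (0 : Site 3) ![((k * n : ℕ) : ℤ), n, n]) x y}) :
    PercTiltedBlockers.CubeBlockingSeed :=
  stub_cruxOfFlatAnnulusCrossingOfHalvingRung h6699 hR

/-- **Consistency of the tall halving rung with `X_B`**: `CritAnnulusNonCrossing (0846) ⟹ HalvingRung`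
(0846 ⟹ CubeBlockingSeed, `SubpolynomialBlocking.cubeBlockingSeed_of_critAnnulusNonCrossing`, then the crux
gives every rung outright, `halvingRung_of_cubeBlockingSeed`). So the rung is not stronger than what both routes already
bet on. [folklore] -/
theorem halvingRung_of_critAnnulusNonCrossing (h0846 : PercAnnulusCrossing.CritAnnulusNonCrossing) :
    ∀ k : ℕ, 1 ≤ k →
        (∃ c : ℝ, 0 < c ∧ ∀ n : ℕ, 1 ≤ n →
          c ≤ (bondPercolation (zdGraph 3) (criticalProbI 3)).real
            {ω | ¬ ∃ x ∈ Finset.Icc (0 : Site 3) ![((2 * k * n : ℕ) : ℤ), n, n],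
              ∃ y ∈ Finset.Icc (0 : Site 3) ![((2 * k * n : ℕ) : ℤ), n, n],
                x 0 = 0 ∧ y 0 = ((2 * k * n : ℕ) : ℤ) ∧
                  ω ∈ openConnIn ↑(Finset.Icc (0 : Site 3) ![((2 * k * n : ℕ) : ℤ), n, n]) x y}) →
        ∃ c : ℝ, 0 < c ∧ ∀ n : ℕ, 1 ≤ n →
          c ≤ (bondPercolation (zdGraph 3) (criticalProbI 3)).real
            {ω | ¬ ∃ x ∈ Finset.Icc (0 : Site 3) ![((k * n : ℕ) : ℤ), n, n],
              ∃ y ∈ Finset.Icc (0 : Site 3) ![((k * n : ℕ) : ℤ), n, n],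
                x 0 = 0 ∧ y 0 = ((k * n : ℕ) : ℤ) ∧
                  ω ∈ openConnIn ↑(Finset.Icc (0 : Site 3) ![((k * n : ℕ) : ℤ), n, n]) x y} :=
  halvingRung_of_cubeBlockingSeed
    (cubeBlockingSeed_shared_iff.1
      (SubpolynomialBlocking.cubeBlockingSeed_of_critAnnulusNonCrossing h0846))

/-- **Given `FlatAnnulusCrossing` (6699), the crux is EQUIVALENT to the tall halving rung** (the crux gives every rung;
6699 and the rungs give the crux). [folklore] -/
theorem cubeBlockingSeed_iff_halvingRung_of_flatAnnulusCrossing (h6699 : PercDivergentSlabLadder.FlatAnnulusCrossing) :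
    PercAnnulusCrossing.CubeBlockingSeed ↔
      ∀ k : ℕ, 1 ≤ k →
        (∃ c : ℝ, 0 < c ∧ ∀ n : ℕ, 1 ≤ n →
          c ≤ (bondPercolation (zdGraph 3) (criticalProbI 3)).real
            {ω | ¬ ∃ x ∈ Finset.Icc (0 : Site 3) ![((2 * k * n : ℕ) : ℤ), n, n],
              ∃ y ∈ Finset.Icc (0 : Site 3) ![((2 * k * n : ℕ) : ℤ), n, n],
                x 0 = 0 ∧ y 0 = ((2 * k * n : ℕ) : ℤ) ∧
                  ω ∈ openConnIn ↑(Finset.Icc (0 : Site 3) ![((2 * k * n : ℕ) : ℤ), n, n]) x y}) →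
        ∃ c : ℝ, 0 < c ∧ ∀ n : ℕ, 1 ≤ n →
          c ≤ (bondPercolation (zdGraph 3) (criticalProbI 3)).real
            {ω | ¬ ∃ x ∈ Finset.Icc (0 : Site 3) ![((k * n : ℕ) : ℤ), n, n],
              ∃ y ∈ Finset.Icc (0 : Site 3) ![((k * n : ℕ) : ℤ), n, n],
                x 0 = 0 ∧ y 0 = ((k * n : ℕ) : ℤ) ∧
                  ω ∈ openConnIn ↑(Finset.Icc (0 : Site 3) ![((k * n : ℕ) : ℤ), n, n]) x y} :=
  ⟨fun h => halvingRung_of_cubeBlockingSeed (cubeBlockingSeed_shared_iff.1 h),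
    fun hR => cubeBlockingSeed_of_flatAnnulusCrossing_of_halvingRung h6699 hR⟩

end Summit.CriticalPhenomena.PercolationContinuityZ3.Theorems.CubeBlockingSeed

end
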